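import Mathlib
import HarnessLib
import Summits.Ventures.LatticeQCDFlow.Scaling.TorusRankedLayers

/-!
# LatticeQCDFlow / Scaling — a ranked structure of `(ℤ/L)³` leaving exactly `L³ + 2` plaquettes outside:
# the layers, a comb on the bottom plane, and a spanning comb-tree of vertical plaquettes in the top layer

HONEST FRAMING: exact (Metropolis-corrected) sampling algorithms for lattice gauge theory;
figures of merit are autocorrelation/cost numbers at stated couplings and volumes; no
continuum-physics claim.

Venture `LatticeQCDFlow` (cell pub-lqcd), topic `Scaling`, FANOUT row 30 (lean-1, GEN-24) — OUR WORK on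
THEORY-2.md §4 row C5.  `TorusRankedParityBound`: every ranked structure of `(ℤ/L)³` leaves `k ≥ L³ − 1`
plaquettes outside; `TorusRankedLayers`: `k = L³ + 2L²` is attained.  THIS FILE (with its sequel
`TorusRankedThreeDimCount`) closes the gap to three plaquettes: the structure `B = B₀ ∪ C ∪ T`,
* `B₀` = the LAYERS: vertical plaquettes `(x; i, 2)` with `x₂ ≠ −1`, `t = (x + e₂, i)`, rank `2L + x₂.val`;
* `C` = the COMB of the bottom plane: horizontal `(x; 0, 1)` with `x₂ = 0`, `x ≠ (−1,−1,0)`,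
  `t = (x + e₀, 1)` if `x₁ = −1` else `(x + e₁, 0)`, rank `L + x₀.val`, resp. `x₁.val`;
* `T` = the COMB-TREE of the top layer: vertical `(x; 0, 2)` with `x₂ = −1`, `x₀ ≠ −1` (`t = (x + e₀, 2)`,
  rank `4L + L·x₁.val + x₀.val`) and `(x; 1, 2)` with `x₂ = −1`, `x₀ = 0`, `x₁ ≠ −1` (`t = (x + e₁, 2)`,
  rank `3L + x₁.val`) — a spanning tree of the top layer's vertical links, oriented away from the root,
is ranked with an injective top-link assignment (**`threeDim_mem_links`**, **`threeDim_injOn`**,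
**`threeDim_rank_lt`**); `#B = 2L²(L−1) + (L²−1) + (L²−1) = 2L³ − 2`, so `k = L³ + 2` (sequel).  With the
parity bound: the least number of plaquettes outside an exact one-plaquette heat-bath structure of
`(ℤ/L)³` lies in `{L³ − 1, …, L³ + 2}`.

No `def` (the structure is passed as hypotheses `hB`, `ht`, `hr` fixing `B`, `t`, `rank` to explicit
terms), no `sorry`, nothing cited as a fact beyond the tree.
-/

namespace Summit.Ventures.LatticeQCDFlow.Theory2.Autoregressive

open Finset
open Literature.MathematicalPhysics.QuantumFieldTheory

variable {L : ℕ} [NeZero L]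

omit [NeZero L] in
/-- The three coordinate planes of `(ℤ/L)³`. [folklore] -/
theorem plane_three_cases (q : {q : Fin 3 × Fin 3 // q.1 < q.2}) :
    q = ⟨((0 : Fin 3), (1 : Fin 3)), by decide⟩ ∨ q = ⟨((0 : Fin 3), (2 : Fin 3)), by decide⟩ ∨
      q = ⟨((1 : Fin 3), (2 : Fin 3)), by decide⟩ := by
  obtain ⟨⟨i, j⟩, hij⟩ := q
  fin_cases i <;> fin_cases j <;> simp_all <;> exact absurd hij (by decide)

omit [NeZero L] in
/-- **The assignment picks a link of its plaquette.** [ours] -/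
theorem threeDim_mem_links (t : Plaquette 3 L → Edge 3 L)
    (ht : t = fun p => if p.2.1.2 = 2 then
        (if p.1 2 = -1 then (p.1.shift p.2.1.1, (2 : Fin 3)) else (p.1.shift 2, p.2.1.1))
      else (if p.1 1 = -1 then (p.1.shift 0, (1 : Fin 3)) else (p.1.shift 1, (0 : Fin 3))))
    (p : Plaquette 3 L) :
    t p ∈ ({(p.1, p.2.1.1), (p.1.shift p.2.1.1, p.2.1.2), (p.1.shift p.2.1.2, p.2.1.1), (p.1, p.2.1.2)} :
      Finset (Edge 3 L)) := by
  subst ht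
  obtain ⟨x, q⟩ := p
  have h12 : ¬ ((1 : Fin 3) = 2) := by decide
  rcases plane_three_cases q with rfl | rfl | rfl
  · simp only [h12, if_false]
    split_ifs <;> simp
  · simp only [if_true]
    split_ifs <;> simp
  · simp only [if_true]
    split_ifs <;> simp


/-- **The structure is ranked.**  `L ≥ 2`.  For `p ≠ p'` in `B` with `t p` a link of `p'`: `rank p < rank p'`
(layers: the plaquette one layer up or a top-layer tree plaquette; comb: the next comb plaquette, a
bottom-layer vertical plaquette (rank `2L`) or a top-layer one (rank `≥ 3L`); tree: the child edges). [ours] -/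
theorem threeDim_rank_lt (hL : 2 ≤ L) (B : Finset (Plaquette 3 L)) (t : Plaquette 3 L → Edge 3 L)
    (rank : Plaquette 3 L → ℕ)
    (hB : B = Finset.univ.filter (fun p : Plaquette 3 L =>
      (p.2.1.2 = 2 ∧ (p.1 2 ≠ -1 ∨ (p.2.1.1 = 0 ∧ p.1 0 ≠ -1) ∨ (p.2.1.1 = 1 ∧ p.1 0 = 0 ∧ p.1 1 ≠ -1))) ∨
      (p.2.1.2 = 1 ∧ p.1 2 = 0 ∧ ¬ (p.1 0 = -1 ∧ p.1 1 = -1))))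
    (ht : t = fun p => if p.2.1.2 = 2 then
        (if p.1 2 = -1 then (p.1.shift p.2.1.1, (2 : Fin 3)) else (p.1.shift 2, p.2.1.1))
      else (if p.1 1 = -1 then (p.1.shift 0, (1 : Fin 3)) else (p.1.shift 1, (0 : Fin 3))))
    (hr : rank = fun p => if p.2.1.2 = 2 then
        (if p.1 2 = -1 then (if p.2.1.1 = 0 then 4 * L + L * (p.1 1).val + (p.1 0).val else 3 * L + (p.1 1).val)
          else 2 * L + (p.1 2).val)
      else (if p.1 1 = -1 then L + (p.1 0).val else (p.1 1).val)) :
    ∀ p ∈ B, ∀ p' ∈ B, p ≠ p' →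
      t p ∈ ({(p'.1, p'.2.1.1), (p'.1.shift p'.2.1.1, p'.2.1.2), (p'.1.shift p'.2.1.2, p'.2.1.1),
        (p'.1, p'.2.1.2)} : Finset (Edge 3 L)) → rank p < rank p' := by
  haveI : Fact (1 < L) := ⟨hL⟩
  subst ht; subst hB; subst hr
  have h12 : ¬ ((1 : Fin 3) = 2) := by decide
  have h10 : ¬ ((1 : Fin 3) = 0) := by decide
  have h01 : ¬ ((0 : Fin 3) = 1) := by decide
  have h21 : ¬ ((2 : Fin 3) = 1) := by decide
  have hsame : ∀ (y : Site 3 L) (i : Fin 3), (y.shift i) i = y i + 1 := by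
    intro y i; simp [Site.shift]
  have hne' : ∀ (y : Site 3 L) (i j : Fin 3), j ≠ i → (y.shift i) j = y j := by
    intro y i j h; simp [Site.shift, h]
  have hinj : ∀ (y z : Site 3 L) (i : Fin 3), y.shift i = z.shift i → y = z := by
    intro y z i h; simpa [Site.shift] using h
  have hval : ∀ z : ZMod L, z ≠ -1 → (z + 1).val = z.val + 1 := fun z hz => val_add_one_of_ne_neg_one hL hz
  have hvlt : ∀ z : ZMod L, z.val < L := fun z => ZMod.val_lt z
  have hm1 : ∀ z : ZMod L, z ≠ -1 → z + 1 ≠ 0 := fun z hz h => hz (eq_neg_of_add_eq_zero_left h)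
  have h0m1 : (0 : ZMod L) ≠ -1 := fun h => (neg_ne_zero.mpr (one_ne_zero (α := ZMod L))) h.symm
  intro p hp p' hp' hne hmem
  simp only [mem_filter, mem_univ, true_and] at hp hp'
  obtain ⟨x, q⟩ := p
  obtain ⟨x', q'⟩ := p'
  rcases plane_three_cases q with rfl | rfl | rfl <;> rcases plane_three_cases q' with rfl | rfl | rfl <;>
    simp only [h12, h10, h01, h21, if_false, if_true, false_and, false_or, or_false, true_and,
      Finset.mem_insert, Finset.mem_singleton, Fin.isValue] at hp hp' hmem ⊢
  -- (01, 01): comb against comb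
  · obtain ⟨-, hxc⟩ := hp
    obtain ⟨-, hxc'⟩ := hp'
    by_cases h1 : x 1 = -1
    · rw [if_pos h1] at hmem ⊢
      simp only [Prod.mk.injEq] at hmem
      have hx0 : x 0 ≠ -1 := fun h0 => hxc ⟨h0, h1⟩
      rcases hmem with ⟨-, h⟩ | ⟨h, -⟩ | ⟨-, h⟩ | ⟨h, -⟩
      · exact absurd h (by decide)
      · exact (hne (by rw [hinj x x' 0 h])).elim
      · exact absurd h (by decide)
      · have h1' : x' 1 = -1 := by rw [← h, hne' x 0 1 (by decide), h1]
        rw [if_pos h1', ← h, hsame, hval _ hx0]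
        omega
    · rw [if_neg h1] at hmem ⊢
      simp only [Prod.mk.injEq] at hmem
      rcases hmem with ⟨h, -⟩ | ⟨-, h⟩ | ⟨h, -⟩ | ⟨-, h⟩
      · by_cases h1' : x' 1 = -1
        · rw [if_pos h1']; have := hvlt (x 1); omega
        · rw [if_neg h1', ← h, hsame, hval _ h1]; omega
      · exact absurd h (by decide)
      · exact (hne (by rw [hinj x x' 1 h])).elim
      · exact absurd h (by decide)
  -- (01, 02): comb against vertical — every vertical rank is ≥ 2L
  · have := hvlt (x 0); have := hvlt (x 1)
    split_ifs <;> omega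
  -- (01, 12)
  · have := hvlt (x 0); have := hvlt (x 1)
    split_ifs <;> omega
  -- (02, 01): vertical against comb — its link is never on a bottom-plane plaquette
  · obtain ⟨hx2', -⟩ := hp'
    by_cases hx2 : x 2 = -1
    · rw [if_pos hx2] at hmem
      simp only [Prod.mk.injEq] at hmem
      rcases hmem with ⟨-, h⟩ | ⟨-, h⟩ | ⟨-, h⟩ | ⟨-, h⟩ <;> exact absurd h (by decide)
    · rw [if_neg hx2] at hmem
      simp only [Prod.mk.injEq] at hmem
      exfalso
      rcases hmem with ⟨h, -⟩ | ⟨-, h⟩ | ⟨h, -⟩ | ⟨-, h⟩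
      · have hc := congrFun h 2; simp [Site.shift] at hc; exact hm1 _ hx2 (by rw [hc, hx2'])
      · exact absurd h (by decide)
      · have hc := congrFun h 2; simp [Site.shift] at hc; exact hm1 _ hx2 (by rw [hc, hx2'])
      · exact absurd h (by decide)
  -- (02, 02)
  · by_cases hx2 : x 2 = -1
    · rw [if_pos hx2] at hmem ⊢
      simp only [Prod.mk.injEq] at hmem
      have hx0 : x 0 ≠ -1 := by rcases hp with h | h <;> [exact absurd hx2 h; exact h]
      rcases hmem with ⟨-, h⟩ | ⟨h, -⟩ | ⟨-, h⟩ | ⟨h, -⟩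
      · exact absurd h (by decide)
      · exact (hne (by rw [hinj x x' 0 h])).elim
      · exact absurd h (by decide)
      · -- `x' = x + e₀`: the next row edge of the tree
        have hx2' : x' 2 = -1 := by rw [← h, hne' x 0 2 (by decide), hx2]
        rw [if_pos hx2', ← h, hsame, hne' x 0 1 (by decide), hval _ hx0]
        omega
    · rw [if_neg hx2] at hmem ⊢
      simp only [Prod.mk.injEq] at hmem
      rcases hmem with ⟨h, -⟩ | ⟨-, h⟩ | ⟨h, -⟩ | ⟨-, h⟩
      · -- `x' = x + e₂`: one layer up (a layer or a tree plaquette)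
        rw [← h]
        simp only [hsame, hne' x 2 1 (by decide), hne' x 2 0 (by decide)]
        have := hvlt (x 2)
        split_ifs with h'
        · omega
        · rw [hval _ hx2]; omega
      · exact absurd h (by decide)
      · exact (hne (by rw [hinj x x' 2 h])).elim
      · exact absurd h (by decide)
  -- (02, 12)
  · by_cases hx2 : x 2 = -1
    · rw [if_pos hx2] at hmem ⊢
      simp only [Prod.mk.injEq] at hmem
      have hx0 : x 0 ≠ -1 := by rcases hp with h | h <;> [exact absurd hx2 h; exact h]
      exfalso
      rcases hmem with ⟨-, h⟩ | ⟨h, -⟩ | ⟨-, h⟩ | ⟨h, -⟩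
      · exact absurd h (by decide)
      · -- `x + e₀ = x' + e₁` with `x' 0 = 0`: `x 0 = −1`
        have hx2' : x' 2 = -1 := by
          have hc := congrFun h 2; simp [Site.shift] at hc; rw [← hc, hx2]
        have htc : x' 0 = 0 ∧ x' 1 ≠ -1 := by rcases hp' with h' | h' <;> [exact absurd hx2' h'; exact h']
        have hc := congrFun h 0; simp [Site.shift] at hc
        exact hm1 _ hx0 (by rw [hc, htc.1])
      · exact absurd h (by decide)
      · -- `x' = x + e₀` with `x' 0 = 0`: again `x 0 = −1`
        have hx2' : x' 2 = -1 := by rw [← h, hne' x 0 2 (by decide), hx2]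
        have htc : x' 0 = 0 ∧ x' 1 ≠ -1 := by rcases hp' with h' | h' <;> [exact absurd hx2' h'; exact h']
        have hc : x' 0 = x 0 + 1 := by rw [← h, hsame]
        exact hm1 _ hx0 (by rw [← hc, htc.1])
    · rw [if_neg hx2] at hmem ⊢
      simp only [Prod.mk.injEq] at hmem
      rcases hmem with ⟨-, h⟩ | ⟨-, h⟩ | ⟨-, h⟩ | ⟨-, h⟩ <;> exact absurd h (by decide)
  -- (12, 01)
  · obtain ⟨hx2', -⟩ := hp'
    by_cases hx2 : x 2 = -1
    · rw [if_pos hx2] at hmem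
      simp only [Prod.mk.injEq] at hmem
      rcases hmem with ⟨-, h⟩ | ⟨-, h⟩ | ⟨-, h⟩ | ⟨-, h⟩ <;> exact absurd h (by decide)
    · rw [if_neg hx2] at hmem
      simp only [Prod.mk.injEq] at hmem
      exfalso
      rcases hmem with ⟨-, h⟩ | ⟨h, -⟩ | ⟨-, h⟩ | ⟨h, -⟩
      · exact absurd h (by decide)
      · have hc := congrFun h 2; simp [Site.shift] at hc; exact hm1 _ hx2 (by rw [hc, hx2'])
      · exact absurd h (by decide)
      · have hc := congrFun h 2; simp [Site.shift] at hc; exact hm1 _ hx2 (by rw [hc, hx2'])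
  -- (12, 02)
  · by_cases hx2 : x 2 = -1
    · rw [if_pos hx2] at hmem ⊢
      simp only [Prod.mk.injEq] at hmem
      have htc : x 0 = 0 ∧ x 1 ≠ -1 := by rcases hp with h | h <;> [exact absurd hx2 h; exact h]
      rcases hmem with ⟨-, h⟩ | ⟨h, -⟩ | ⟨-, h⟩ | ⟨h, -⟩
      · exact absurd h (by decide)
      · -- `x + e₁ = x' + e₀`: `x' 0 = −1`, but a top row edge has `x' 0 ≠ −1`
        exfalso
        have hx2' : x' 2 = -1 := by
          have hc := congrFun h 2; simp [Site.shift] at hc; rw [← hc, hx2]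
        have hx0' : x' 0 ≠ -1 := by rcases hp' with h' | h' <;> [exact absurd hx2' h'; exact h']
        have hc := congrFun h 0; simp [Site.shift] at hc
        rw [htc.1] at hc
        exact hx0' (eq_neg_of_add_eq_zero_left hc.symm)
      · exact absurd h (by decide)
      · -- `x' = x + e₁`: a row edge starting at the tree vertex above: rank ≥ 4L
        have := hvlt (x 1)
        have hx2' : x' 2 = -1 := by rw [← h, hne' x 1 2 (by decide), hx2]
        rw [if_pos hx2']
        omega
    · rw [if_neg hx2] at hmem ⊢
      simp only [Prod.mk.injEq] at hmem
      rcases hmem with ⟨-, h⟩ | ⟨-, h⟩ | ⟨-, h⟩ | ⟨-, h⟩ <;> exact absurd h (by decide)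
  -- (12, 12)
  · by_cases hx2 : x 2 = -1
    · rw [if_pos hx2] at hmem ⊢
      simp only [Prod.mk.injEq] at hmem
      have htc : x 0 = 0 ∧ x 1 ≠ -1 := by rcases hp with h | h <;> [exact absurd hx2 h; exact h]
      rcases hmem with ⟨-, h⟩ | ⟨h, -⟩ | ⟨-, h⟩ | ⟨h, -⟩
      · exact absurd h (by decide)
      · exact (hne (by rw [hinj x x' 1 h])).elim
      · exact absurd h (by decide)
      · -- `x' = x + e₁`: the next column edge
        have hx2' : x' 2 = -1 := by rw [← h, hne' x 1 2 (by decide), hx2]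
        rw [if_pos hx2', ← h, hsame, hval _ htc.2]
        omega
    · rw [if_neg hx2] at hmem ⊢
      simp only [Prod.mk.injEq] at hmem
      rcases hmem with ⟨h, -⟩ | ⟨-, h⟩ | ⟨h, -⟩ | ⟨-, h⟩
      · rw [← h]
        simp only [hsame, hne' x 2 1 (by decide)]
        have := hvlt (x 2)
        split_ifs with h'
        · omega
        · rw [hval _ hx2]; omega
      · exact absurd h (by decide)
      · exact (hne (by rw [hinj x x' 2 h])).elim
      · exact absurd h (by decide)


/-- **Injectivity on `B`.**  The layers use horizontal links at heights `≠ 0`, the comb horizontal links at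
height `0`, the tree vertical links; inside each family the link determines the plaquette. [ours] -/
theorem threeDim_injOn (B : Finset (Plaquette 3 L)) (t : Plaquette 3 L → Edge 3 L)
    (hB : B = Finset.univ.filter (fun p : Plaquette 3 L =>
      (p.2.1.2 = 2 ∧ (p.1 2 ≠ -1 ∨ (p.2.1.1 = 0 ∧ p.1 0 ≠ -1) ∨ (p.2.1.1 = 1 ∧ p.1 0 = 0 ∧ p.1 1 ≠ -1))) ∨
      (p.2.1.2 = 1 ∧ p.1 2 = 0 ∧ ¬ (p.1 0 = -1 ∧ p.1 1 = -1))))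
    (ht : t = fun p => if p.2.1.2 = 2 then
        (if p.1 2 = -1 then (p.1.shift p.2.1.1, (2 : Fin 3)) else (p.1.shift 2, p.2.1.1))
      else (if p.1 1 = -1 then (p.1.shift 0, (1 : Fin 3)) else (p.1.shift 1, (0 : Fin 3)))) :
    Set.InjOn t ↑B := by
  subst ht; subst hB
  have h12 : ¬ ((1 : Fin 3) = 2) := by decide
  have h10 : ¬ ((1 : Fin 3) = 0) := by decide
  have h01 : ¬ ((0 : Fin 3) = 1) := by decide
  have h21 : ¬ ((2 : Fin 3) = 1) := by decide
  have hinj : ∀ (y z : Site 3 L) (i : Fin 3), y.shift i = z.shift i → y = z := by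
    intro y z i h; simpa [Site.shift] using h
  have hm1 : ∀ z : ZMod L, z ≠ -1 → z + 1 ≠ 0 := fun z hz h => hz (eq_neg_of_add_eq_zero_left h)
  intro p hp p' hp' h
  simp only [coe_filter, mem_univ, true_and, Set.mem_setOf_eq] at hp hp'
  obtain ⟨x, q⟩ := p
  obtain ⟨x', q'⟩ := p'
  rcases plane_three_cases q with rfl | rfl | rfl <;> rcases plane_three_cases q' with rfl | rfl | rfl <;>
    simp only [h12, h10, h01, h21, if_false, if_true, false_and, false_or, or_false, true_and,
      Fin.isValue] at hp hp' h ⊢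
  -- (01, 01)
  · by_cases h1 : x 1 = -1 <;> by_cases h1' : x' 1 = -1 <;>
      simp only [h1, h1', if_true, if_false, Prod.mk.injEq] at h
    · rw [hinj x x' 0 h.1]
    · exact absurd h.2 (by decide)
    · exact absurd h.2 (by decide)
    · rw [hinj x x' 1 h.1]
  -- (01, 02): a comb link (height 0, direction ≤ 1) is not a layer / tree link
  · exfalso
    obtain ⟨hx2, -⟩ := hp
    by_cases h1 : x 1 = -1 <;> by_cases hx2' : x' 2 = -1 <;>
      simp only [h1, hx2', if_true, if_false, Prod.mk.injEq] at h
    · exact absurd h.2 (by decide)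
    · exact absurd h.2 (by decide)
    · exact absurd h.2 (by decide)
    · have hc := congrFun h.1 2; simp [Site.shift] at hc; exact hm1 _ hx2' (by rw [← hc, hx2])
  -- (01, 12)
  · exfalso
    obtain ⟨hx2, -⟩ := hp
    by_cases h1 : x 1 = -1 <;> by_cases hx2' : x' 2 = -1 <;>
      simp only [h1, hx2', if_true, if_false, Prod.mk.injEq] at h
    · exact absurd h.2 (by decide)
    · have hc := congrFun h.1 2; simp [Site.shift] at hc; exact hm1 _ hx2' (by rw [← hc, hx2])
    · exact absurd h.2 (by decide)
    · exact absurd h.2 (by decide)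
  -- (02, 01)
  · exfalso
    obtain ⟨hx2', -⟩ := hp'
    by_cases hx2 : x 2 = -1 <;> by_cases h1' : x' 1 = -1 <;>
      simp only [hx2, h1', if_true, if_false, Prod.mk.injEq] at h
    · exact absurd h.2 (by decide)
    · exact absurd h.2 (by decide)
    · exact absurd h.2 (by decide)
    · have hc := congrFun h.1 2; simp [Site.shift] at hc; exact hm1 _ hx2 (by rw [hc, hx2'])
  -- (02, 02)
  · by_cases hx2 : x 2 = -1 <;> by_cases hx2' : x' 2 = -1 <;>
      simp only [hx2, hx2', if_true, if_false, Prod.mk.injEq] at h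
    · rw [hinj x x' 0 h.1]
    · exact absurd h.2 (by decide)
    · exact absurd h.2 (by decide)
    · rw [hinj x x' 2 h.1]
  -- (02, 12)
  · exfalso
    by_cases hx2 : x 2 = -1 <;> by_cases hx2' : x' 2 = -1 <;>
      simp only [hx2, hx2', if_true, if_false, Prod.mk.injEq] at h
    · -- `x + e₀ = x' + e₁` with `x 0 ≠ −1`, `x' 0 = 0`
      have hx0 : x 0 ≠ -1 := by rcases hp with h' | h' <;> [exact absurd hx2 h'; exact h']
      have htc : x' 0 = 0 ∧ x' 1 ≠ -1 := by rcases hp' with h' | h' <;> [exact absurd hx2' h'; exact h']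
      have hc := congrFun h.1 0; simp [Site.shift] at hc
      exact hm1 _ hx0 (by rw [hc, htc.1])
    · exact absurd h.2 (by decide)
    · exact absurd h.2 (by decide)
    · exact absurd h.2 (by decide)
  -- (12, 01)
  · exfalso
    obtain ⟨hx2', -⟩ := hp'
    by_cases hx2 : x 2 = -1 <;> by_cases h1' : x' 1 = -1 <;>
      simp only [hx2, h1', if_true, if_false, Prod.mk.injEq] at h
    · exact absurd h.2 (by decide)
    · exact absurd h.2 (by decide)
    · have hc := congrFun h.1 2; simp [Site.shift] at hc; exact hm1 _ hx2 (by rw [hc, hx2'])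
    · exact absurd h.2 (by decide)
  -- (12, 02)
  · exfalso
    by_cases hx2 : x 2 = -1 <;> by_cases hx2' : x' 2 = -1 <;>
      simp only [hx2, hx2', if_true, if_false, Prod.mk.injEq] at h
    · have htc : x 0 = 0 ∧ x 1 ≠ -1 := by rcases hp with h' | h' <;> [exact absurd hx2 h'; exact h']
      have hx0' : x' 0 ≠ -1 := by rcases hp' with h' | h' <;> [exact absurd hx2' h'; exact h']
      have hc := congrFun h.1 0; simp [Site.shift] at hc
      rw [htc.1] at hc
      exact hx0' (eq_neg_of_add_eq_zero_left hc.symm)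
    · exact absurd h.2 (by decide)
    · exact absurd h.2 (by decide)
    · exact absurd h.2 (by decide)
  -- (12, 12)
  · by_cases hx2 : x 2 = -1 <;> by_cases hx2' : x' 2 = -1 <;>
      simp only [hx2, hx2', if_true, if_false, Prod.mk.injEq] at h
    · rw [hinj x x' 1 h.1]
    · exact absurd h.2 (by decide)
    · exact absurd h.2 (by decide)
    · rw [hinj x x' 2 h.1]

end Summit.Ventures.LatticeQCDFlow.Theory2.Autoregressive
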